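import Mathlib
import Summits.ValiantsHypothesis.ValiantsHypothesis.Theorems.NewtonUnitEquationsDissociatedUniformTotalsLaw
import Summits.ValiantsHypothesis.ValiantsHypothesis.Theorems.NewtonUnitEquationsDissociatedUniformTotalsLawSweep
import Summits.ValiantsHypothesis.ValiantsHypothesis.Theorems.NewtonUnitEquationsDissociatedUniformTotalsLawHeavyPairs
import Summits.ValiantsHypothesis.ValiantsHypothesis.Theorems.NewtonUnitEquationsDissociatedUniformTotalsLawTriangleWords
import Summits.ValiantsHypothesis.ValiantsHypothesis.Theorems.NewtonUnitEquationsDissociatedUniformTotalsLawChartSamples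
import Summits.ValiantsHypothesis.ValiantsHypothesis.Theorems.NewtonUnitEquationsDissociatedUniformTotalsLawChartTriangles
import Literature.Computability.AlgebraicComplexity.NewtonPolygonTauProductBounds
import HarnessLib

/-!
# Crux `NewtonUnitEquations.DissociatedUniform` (stmt-ValiantsHypothesis-5905), `n = 3` totals law of model (Q**):
# the located UP-CROSSING LAW and its kernel bridge `UpCrossingLaw C → T ≤ (18 + 24·C·log₂|G|)·|G|²`

The sub-cubic bound (`…TotalsLawSubCubic`, `T ≤ 108(√q+1)q²`) has exactly one lossy step: the heavy-pair count
`#heavyPairs(m) ≤ 8q³/m²` of `…HeavyPairs`, which bounds the number of STRONG UP-CROSSINGS (`suc`) only through the global budget of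
fibre entries, `⌈m/2⌉·Σ_ℓ #suc_ℓ(m) ≤ q²`.  For the REALISED systems (the tie-broken pair tops along a chart, `…ChartSamples`) the census
of this seat says much more (exact event sweeps, HOME g14/exp/suc6_census.py; the six degree views = first/second letter of the `P`, `Q`,
`R` tops; `q ≤ 40`): for every `m ≥ 3`, `Σ_ℓ #suc_ℓ(m) ≤ 1.2·q` on every family probed (random clouds `≤ 0.71q`, decaying in `m`;
parabola pair × circle `≤ 0.97q`; parabola gadget FLAT `≈ 0.53q` for all `3 ≤ m ≤ q/2`; clustered alphabets `≤ 1.19q`; three circles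
`≤ 1.08q`; adversarial annealing of the count itself at `q = 10, 14`: `≤ 1.4q`), while at `m = 2` it is genuinely quadratic (`≈ 0.45q²` for
convex families: degree flicker `1 ↔ 2`).  Hence the located rung
* `@[conjecture] UpCrossingLaw C` — for `σ = ±1` and every `m ≥ 3`, each of the six views has `Σ_ℓ #suc(Nσ, T, m, ℓ) ≤ C·|G|`; OPEN, located
  `C = 2`, asserted nowhere —
and its KERNEL BRIDGE: `heavyPairs_mul_le_of_suc_le` (`(⌊m/2⌋+1)·#HP ≤ q·(B_R + B_Q)` from bounds on the two up-crossing sums),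
`sum_min_topDeg_le_of_levels` (layer cake with a per-level bound `M` for levels `2^j ≥ 4`: `Σ min ≤ 3q² + M·log₂ q`), the three birth
counts in that form, and **`totalVert_le_of_upCrossingLaw : UpCrossingLaw C → ∀ G a b c, T ≤ (18 + 24·C·Nat.log 2 |G|)·|G|²`** — the up-crossing
law would bring the general exponent from `5/2` to `2 + o(1)` (a `log`).  Honest label: location + bridge only; `UpCrossingLaw`, `TriWordsBound`,
`TotalsLawThree` are OPEN; VP ≠ VNP is not touched.
[folklore]
-/

set_option linter.dupNamespace false -- `ValiantsHypothesis.ValiantsHypothesis` (summit = problem) in every name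

open Finset Matrix

namespace Summit.ValiantsHypothesis.ValiantsHypothesis.Theorems.NewtonUnitEquationsDissociatedUniform

namespace TotalsLaw

open Literature.Computability.AlgebraicComplexity.KPTT.PlanarMinkowski

section Abstract

variable {G : Type*} [Fintype G] [DecidableEq G]

/-- **Heavy pairs from up-crossing budgets.**  If `Σ_x #suc_R(m) ≤ B_R` and `Σ_y #suc_Q(m) ≤ B_Q` (`m ≥ 1`), then
`(⌊m/2⌋ + 1)·#heavyPairs(m) ≤ |G|·(B_R + B_Q)`. [folklore] -/
theorem heavyPairs_mul_le_of_suc_le {N : ℕ} (TQ TR : ℕ → G → G) {m : ℕ} (hm : 1 ≤ m) {BQ BR : ℕ}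
    (hQ : ∑ y, (suc N TQ m y).card ≤ BQ) (hR : ∑ x, (suc N TR m x).card ≤ BR) :
    (m / 2 + 1) * (heavyPairs N TQ TR m).card ≤ Fintype.card G * (BR + BQ) := by
  classical
  set q := Fintype.card G with hq
  set h := m / 2 + 1 with hh
  set A := univ.biUnion fun x => (suc N TR m x).biUnion fun r =>
      (univ.filter fun y => h ≤ topDeg TQ r y).image fun y => (x, y) with hA
  set B := univ.biUnion fun y => (suc N TQ m y).biUnion fun r =>
      (univ.filter fun x => h ≤ topDeg TR r x).image fun x => (x, y) with hB
  have hcov : (heavyPairs N TQ TR m).card ≤ A.card + B.card :=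
    (card_le_card (heavyPairs_subset TQ TR hm)).trans (card_union_le _ _)
  have hAc : h * A.card ≤ q * ∑ x, (suc N TR m x).card := by
    calc h * A.card ≤ h * ∑ x, ∑ r ∈ suc N TR m x, ((univ.filter fun y => h ≤ topDeg TQ r y).image fun y => (x, y)).card := by
          gcongr
          exact card_biUnion_le.trans (sum_le_sum fun x _ => card_biUnion_le)
      _ = ∑ x, ∑ r ∈ suc N TR m x, h * ((univ.filter fun y => h ≤ topDeg TQ r y).image fun y => (x, y)).card := by
          rw [mul_sum]; refine sum_congr rfl fun x _ => ?_; rw [mul_sum]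
      _ ≤ ∑ x, ∑ _r ∈ suc N TR m x, q := by
          gcongr with x _ r _
          exact (Nat.mul_le_mul_left _ card_image_le).trans (mul_card_heavy_le TQ r h)
      _ = q * ∑ x, (suc N TR m x).card := by
          rw [mul_sum]; refine sum_congr rfl fun x _ => ?_; rw [sum_const, smul_eq_mul, mul_comm]
  have hBc : h * B.card ≤ q * ∑ y, (suc N TQ m y).card := by
    calc h * B.card ≤ h * ∑ y, ∑ r ∈ suc N TQ m y, ((univ.filter fun x => h ≤ topDeg TR r x).image fun x => (x, y)).card := by
          gcongr
          exact card_biUnion_le.trans (sum_le_sum fun y _ => card_biUnion_le)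
      _ = ∑ y, ∑ r ∈ suc N TQ m y, h * ((univ.filter fun x => h ≤ topDeg TR r x).image fun x => (x, y)).card := by
          rw [mul_sum]; refine sum_congr rfl fun y _ => ?_; rw [mul_sum]
      _ ≤ ∑ y, ∑ _r ∈ suc N TQ m y, q := by
          gcongr with y _ r _
          exact (Nat.mul_le_mul_left _ card_image_le).trans (mul_card_heavy_le TR r h)
      _ = q * ∑ y, (suc N TQ m y).card := by
          rw [mul_sum]; refine sum_congr rfl fun y _ => ?_; rw [sum_const, smul_eq_mul, mul_comm]
  calc h * (heavyPairs N TQ TR m).card ≤ h * A.card + h * B.card := by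
        rw [← mul_add]; exact Nat.mul_le_mul_left _ hcov
    _ ≤ q * ∑ x, (suc N TR m x).card + q * ∑ y, (suc N TQ m y).card := add_le_add hAc hBc
    _ ≤ q * BR + q * BQ := add_le_add (Nat.mul_le_mul_left _ hR) (Nat.mul_le_mul_left _ hQ)
    _ = q * (BR + BQ) := by ring

/-- Dyadic form: if both up-crossing sums at level `2^j` (`j ≥ 1`) are `≤ B`, then `2^j · #heavyPairs(2^j) ≤ 4·|G|·B`. [folklore] -/
theorem pow_mul_card_heavyPairs_le_of_suc_le {N : ℕ} (TQ TR : ℕ → G → G) {j : ℕ} (hj : 1 ≤ j) {B : ℕ}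
    (hQ : ∑ y, (suc N TQ (2 ^ j) y).card ≤ B) (hR : ∑ x, (suc N TR (2 ^ j) x).card ≤ B) :
    2 ^ j * (heavyPairs N TQ TR (2 ^ j)).card ≤ 4 * Fintype.card G * B := by
  have h := heavyPairs_mul_le_of_suc_le TQ TR (Nat.one_le_two_pow) hQ hR
  obtain ⟨k, rfl⟩ : ∃ k, j = k + 1 := ⟨j - 1, by omega⟩
  have e2 : 2 ^ (k + 1) / 2 + 1 = 2 ^ k + 1 := by rw [pow_succ]; omega
  rw [e2] at h
  calc 2 ^ (k + 1) * (heavyPairs N TQ TR (2 ^ (k + 1))).card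
      ≤ 2 * ((2 ^ k + 1) * (heavyPairs N TQ TR (2 ^ (k + 1))).card) := by
        rw [pow_succ]; nlinarith [Nat.zero_le (heavyPairs N TQ TR (2 ^ (k + 1))).card]
    _ ≤ 2 * (Fintype.card G * (B + B)) := Nat.mul_le_mul_left _ h
    _ = 4 * Fintype.card G * B := by ring

/-- **Layer cake with a per-level bound.**  If `2^j · #heavyPairs(2^j) ≤ M` for every level `2 ≤ j ≤ log₂|G|`, then for any times
`b p ≤ N`, `Σ_{(x,y)} min (deg_Q y) (deg_R x) ≤ 3|G|² + M · log₂|G|`. [folklore] -/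
theorem sum_min_topDeg_le_of_levels {N : ℕ} {TQ TR : ℕ → G → G} (b : G × G → ℕ) (hb : ∀ p, b p ≤ N) {M : ℕ}
    (hlev : ∀ j, 2 ≤ j → j ≤ Nat.log 2 (Fintype.card G) → 2 ^ j * (heavyPairs N TQ TR (2 ^ j)).card ≤ M) :
    ∑ p : G × G, min (topDeg TQ (b p) p.2) (topDeg TR (b p) p.1) ≤
      3 * Fintype.card G ^ 2 + M * Nat.log 2 (Fintype.card G) := by
  classical
  set q := Fintype.card G with hq
  set J := Nat.log 2 q with hJ
  set f : G × G → ℕ := fun p => min (topDeg TQ (b p) p.2) (topDeg TR (b p) p.1) with hf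
  have hfq : ∀ p, f p ≤ q := fun p => (min_le_left _ _).trans (topDeg_le _ _ _)
  have step1 : ∑ p, f p ≤ ∑ j ∈ range (J + 1), 2 ^ j * (heavyPairs N TQ TR (2 ^ j)).card := by
    calc ∑ p, f p ≤ ∑ p : G × G, ∑ j ∈ range (J + 1), 2 ^ j * (if 2 ^ j ≤ f p then 1 else 0) :=
          sum_le_sum fun p _ => le_sum_pow_indicator (hfq p)
      _ = ∑ j ∈ range (J + 1), 2 ^ j * ∑ p : G × G, (if 2 ^ j ≤ f p then 1 else 0) := by
          rw [sum_comm]; exact sum_congr rfl fun j _ => by rw [mul_sum]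
      _ ≤ ∑ j ∈ range (J + 1), 2 ^ j * (heavyPairs N TQ TR (2 ^ j)).card := by
          refine sum_le_sum fun j _ => Nat.mul_le_mul_left _ ?_
          rw [← Finset.card_filter]
          refine card_le_card fun p hp => ?_
          obtain ⟨-, hp⟩ := mem_filter.1 hp
          exact mem_filter.2 ⟨mem_univ _, b p, hb p, (le_min_iff.1 hp).1, (le_min_iff.1 hp).2⟩
  have hHP : ∀ j, (heavyPairs N TQ TR (2 ^ j)).card ≤ q ^ 2 := fun j => by
    unfold heavyPairs; exact (card_filter_le _ _).trans (by rw [card_univ, Fintype.card_prod, sq])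
  have step2 : ∀ j ∈ range (J + 1), 2 ^ j * (heavyPairs N TQ TR (2 ^ j)).card ≤
      (if j < 2 then 2 ^ j * q ^ 2 else 0) + (if 2 ≤ j then M else 0) := by
    intro j hj
    by_cases h2 : j < 2
    · rw [if_pos h2, if_neg (by omega), add_zero]; exact Nat.mul_le_mul_left _ (hHP j)
    · rw [if_neg h2, if_pos (by omega), zero_add]
      exact hlev j (by omega) (by have := mem_range.1 hj; omega)
  have step3 : ∑ j ∈ range (J + 1), (if j < 2 then 2 ^ j * q ^ 2 else 0) ≤ 3 * q ^ 2 := by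
    calc ∑ j ∈ range (J + 1), (if j < 2 then 2 ^ j * q ^ 2 else 0)
        ≤ ∑ j ∈ range (J + 1 + 2), (if j < 2 then 2 ^ j * q ^ 2 else 0) :=
          sum_le_sum_of_subset_of_nonneg (range_subset_range.2 (by omega)) fun _ _ _ => Nat.zero_le _
      _ = ∑ j ∈ range 2, 2 ^ j * q ^ 2 := by
          rw [← sum_filter, show (range (J + 1 + 2)).filter (fun j => j < 2) = range 2 from by
            ext j; simp only [mem_filter, mem_range]; omega]
      _ = 3 * q ^ 2 := by simp [sum_range_succ]; ring
  have step4 : ∑ j ∈ range (J + 1), (if 2 ≤ j then M else 0) ≤ M * J := by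
    calc ∑ j ∈ range (J + 1), (if 2 ≤ j then M else 0) = ((range (J + 1)).filter fun j => 2 ≤ j).card * M := by
          rw [← sum_filter, sum_const, smul_eq_mul]
      _ ≤ J * M := by
          refine Nat.mul_le_mul_right _ ?_
          calc ((range (J + 1)).filter fun j => 2 ≤ j).card ≤ (Ico 2 (J + 1)).card :=
                card_le_card fun j hj => by
                  rw [mem_Ico]; have := mem_filter.1 hj; exact ⟨this.2, mem_range.1 this.1⟩
            _ = J + 1 - 2 := Nat.card_Ico _ _
            _ ≤ J := by omega
      _ = M * J := mul_comm _ _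
  calc ∑ p, f p ≤ ∑ j ∈ range (J + 1), 2 ^ j * (heavyPairs N TQ TR (2 ^ j)).card := step1
    _ ≤ ∑ j ∈ range (J + 1), ((if j < 2 then 2 ^ j * q ^ 2 else 0) + (if 2 ≤ j then M else 0)) := sum_le_sum step2
    _ ≤ 3 * q ^ 2 + M * J := by rw [sum_add_distrib]; exact add_le_add step3 step4

end Abstract

/-! ### Birth counts with a per-level bound -/

section Births

variable {G : Type*} [AddCommGroup G] [Fintype G] [DecidableEq G]

open Classical in
/-- The words that are triangles at the birth of their `P`-pair number at most `Σ_{(x,y)} min(deg_Q y, deg_R x)` (birth-time degrees).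
[folklore] -/
theorem card_bornP_le_sum_min {N : ℕ} (TP TQ TR : ℕ → G → G) :
    (univ.filter fun w : G × G × G => IsTri TP TQ TR (birth N TP (w.1 + w.2.1) w.1) w).card ≤
      ∑ p : G × G, min (topDeg TQ (birth N TP (p.1 + p.2) p.1) p.2) (topDeg TR (birth N TP (p.1 + p.2) p.1) p.1) := by
  set W := univ.filter fun w : G × G × G => IsTri TP TQ TR (birth N TP (w.1 + w.2.1) w.1) w with hW
  set b : G × G → ℕ := fun p => birth N TP (p.1 + p.2) p.1 with hb
  have hfib : ∀ p : G × G, (W.filter fun w => (w.1, w.2.1) = p).card ≤ min (topDeg TQ (b p) p.2) (topDeg TR (b p) p.1) := by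
    rintro ⟨x, y⟩
    have hinj : Set.InjOn (fun w : G × G × G => w.2.2) ↑(W.filter fun w => (w.1, w.2.1) = (x, y)) := by
      rintro ⟨x₁, y₁, z₁⟩ h₁ ⟨x₂, y₂, z₂⟩ h₂ (hz : z₁ = z₂)
      have e₁ := (mem_filter.1 (mem_coe.1 h₁)).2
      have e₂ := (mem_filter.1 (mem_coe.1 h₂)).2
      simp only [Prod.mk.injEq] at e₁ e₂
      rw [e₁.1, e₁.2, e₂.1, e₂.2, hz]
    refine le_min ?_ ?_
    · rw [← card_filter_add_eq_topDeg TQ (b (x, y)) y y]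
      refine card_le_card_of_injOn (fun w => w.2.2) (fun w hw => ?_) hinj
      obtain ⟨hwW, hp⟩ := mem_filter.1 hw
      obtain ⟨-, htri⟩ := mem_filter.1 hwW
      simp only [Prod.mk.injEq] at hp
      obtain ⟨-, h2, -⟩ := htri
      rw [hp.1, hp.2] at h2
      exact mem_coe.2 (mem_filter.2 ⟨mem_univ _, h2⟩)
    · rw [← card_filter_add_eq_topDeg TR (b (x, y)) x x]
      refine card_le_card_of_injOn (fun w => w.2.2) (fun w hw => ?_) hinj
      obtain ⟨hwW, hp⟩ := mem_filter.1 hw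
      obtain ⟨-, htri⟩ := mem_filter.1 hwW
      simp only [Prod.mk.injEq] at hp
      obtain ⟨-, -, h3⟩ := htri
      rw [hp.1, hp.2] at h3
      exact mem_coe.2 (mem_filter.2 ⟨mem_univ _, h3⟩)
  calc W.card = ∑ p : G × G, (W.filter fun w => (w.1, w.2.1) = p).card :=
        card_eq_sum_card_fiberwise fun w _ => mem_univ (w.1, w.2.1)
    _ ≤ _ := sum_le_sum fun p _ => hfib p

open Classical in
/-- The words that are triangles at the birth of their `Q`-pair: `≤ Σ_{(y,z)} min(deg'_R z, deg'_P y)` (complementary views).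
[folklore] -/
theorem card_bornQ_le_sum_min {N : ℕ} (TP TQ TR : ℕ → G → G) :
    (univ.filter fun w : G × G × G => IsTri TP TQ TR (birth N TQ (w.2.1 + w.2.2) w.2.1) w).card ≤
      ∑ p : G × G, min (topDeg (coTop TR) (birth N TQ (p.1 + p.2) p.1) p.2)
        (topDeg (coTop TP) (birth N TQ (p.1 + p.2) p.1) p.1) := by
  set W := univ.filter fun w : G × G × G => IsTri TP TQ TR (birth N TQ (w.2.1 + w.2.2) w.2.1) w with hW
  set b : G × G → ℕ := fun p => birth N TQ (p.1 + p.2) p.1 with hb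
  have hfib : ∀ p : G × G, (W.filter fun w => (w.2.1, w.2.2) = p).card ≤
      min (topDeg (coTop TR) (b p) p.2) (topDeg (coTop TP) (b p) p.1) := by
    rintro ⟨y, z⟩
    have hinj : Set.InjOn (fun w : G × G × G => w.1) ↑(W.filter fun w => (w.2.1, w.2.2) = (y, z)) := by
      rintro ⟨x₁, y₁, z₁⟩ h₁ ⟨x₂, y₂, z₂⟩ h₂ (hx : x₁ = x₂)
      have e₁ := (mem_filter.1 (mem_coe.1 h₁)).2
      have e₂ := (mem_filter.1 (mem_coe.1 h₂)).2
      simp only [Prod.mk.injEq] at e₁ e₂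
      rw [e₁.1, e₁.2, e₂.1, e₂.2, hx]
    refine le_min ?_ ?_
    · rw [← card_filter_eq_self_eq_topDeg TR (b (y, z)) z]
      refine card_le_card_of_injOn (fun w => w.1) (fun w hw => ?_) hinj
      obtain ⟨hwW, hp⟩ := mem_filter.1 hw
      obtain ⟨-, htri⟩ := mem_filter.1 hwW
      simp only [Prod.mk.injEq] at hp
      obtain ⟨-, -, h3⟩ := htri
      rw [hp.1, hp.2] at h3
      exact mem_coe.2 (mem_filter.2 ⟨mem_univ _, h3⟩)
    · rw [← card_filter_eq_self_eq_topDeg TP (b (y, z)) y]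
      refine card_le_card_of_injOn (fun w => w.1) (fun w hw => ?_) hinj
      obtain ⟨hwW, hp⟩ := mem_filter.1 hw
      obtain ⟨-, htri⟩ := mem_filter.1 hwW
      simp only [Prod.mk.injEq] at hp
      obtain ⟨h1, -, -⟩ := htri
      rw [hp.1, hp.2] at h1
      exact mem_coe.2 (mem_filter.2 ⟨mem_univ _, h1⟩)
  calc W.card = ∑ p : G × G, (W.filter fun w => (w.2.1, w.2.2) = p).card :=
        card_eq_sum_card_fiberwise fun w _ => mem_univ (w.2.1, w.2.2)
    _ ≤ _ := sum_le_sum fun p _ => hfib p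

open Classical in
/-- The words that are triangles at the birth of their `R`-pair: `≤ Σ_{(x,z)} min(deg'_Q z, deg_P x)`. [folklore] -/
theorem card_bornR_le_sum_min {N : ℕ} (TP TQ TR : ℕ → G → G) :
    (univ.filter fun w : G × G × G => IsTri TP TQ TR (birth N TR (w.1 + w.2.2) w.1) w).card ≤
      ∑ p : G × G, min (topDeg (coTop TQ) (birth N TR (p.1 + p.2) p.1) p.2)
        (topDeg TP (birth N TR (p.1 + p.2) p.1) p.1) := by
  set W := univ.filter fun w : G × G × G => IsTri TP TQ TR (birth N TR (w.1 + w.2.2) w.1) w with hW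
  set b : G × G → ℕ := fun p => birth N TR (p.1 + p.2) p.1 with hb
  have hfib : ∀ p : G × G, (W.filter fun w => (w.1, w.2.2) = p).card ≤
      min (topDeg (coTop TQ) (b p) p.2) (topDeg TP (b p) p.1) := by
    rintro ⟨x, z⟩
    have hinj : Set.InjOn (fun w : G × G × G => w.2.1) ↑(W.filter fun w => (w.1, w.2.2) = (x, z)) := by
      rintro ⟨x₁, y₁, z₁⟩ h₁ ⟨x₂, y₂, z₂⟩ h₂ (hy : y₁ = y₂)
      have e₁ := (mem_filter.1 (mem_coe.1 h₁)).2
      have e₂ := (mem_filter.1 (mem_coe.1 h₂)).2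
      simp only [Prod.mk.injEq] at e₁ e₂
      rw [e₁.1, e₁.2, e₂.1, e₂.2, hy]
    refine le_min ?_ ?_
    · rw [← card_filter_eq_self_eq_topDeg TQ (b (x, z)) z]
      refine card_le_card_of_injOn (fun w => w.2.1) (fun w hw => ?_) hinj
      obtain ⟨hwW, hp⟩ := mem_filter.1 hw
      obtain ⟨-, htri⟩ := mem_filter.1 hwW
      simp only [Prod.mk.injEq] at hp
      obtain ⟨-, h2, -⟩ := htri
      rw [hp.1, hp.2] at h2
      exact mem_coe.2 (mem_filter.2 ⟨mem_univ _, h2⟩)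
    · rw [← card_filter_add_eq_topDeg TP (b (x, z)) x x]
      refine card_le_card_of_injOn (fun w => w.2.1) (fun w hw => ?_) hinj
      obtain ⟨hwW, hp⟩ := mem_filter.1 hw
      obtain ⟨-, htri⟩ := mem_filter.1 hwW
      simp only [Prod.mk.injEq] at hp
      obtain ⟨h1, -, -⟩ := htri
      rw [hp.1, hp.2] at h1
      exact mem_coe.2 (mem_filter.2 ⟨mem_univ _, h1⟩)
  calc W.card = ∑ p : G × G, (W.filter fun w => (w.1, w.2.2) = p).card :=
        card_eq_sum_card_fiberwise fun w _ => mem_univ (w.1, w.2.2)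
    _ ≤ _ := sum_le_sum fun p _ => hfib p

end Births

/-! ### The located up-crossing law and its bridge -/

/-- **Located rung (OPEN): the UP-CROSSING LAW.**  Along each half-chart `σ = ±1`, for every level `m ≥ 3`, each of the six degree
views of the sampled tie-broken pair tops (first and second letters of the `P`-, `Q`-, `R`-tops) has at most `C·|G|` strong
up-crossings in total: `Σ_ℓ #suc(Nσ, T, m, ℓ) ≤ C·|G|`.  Census: `≤ 1.2·|G|` on all families probed (`q ≤ 40`), `≤ 1.4·|G|` under annealing; located `C = 2`;
at `m = 2` the count is quadratic (excluded).  Not asserted anywhere. -/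
@[conjecture] def UpCrossingLaw (C : ℕ) : Prop :=
  ∀ (G : Type) [AddCommGroup G] [Fintype G] [DecidableEq G] (a b c : G → (Fin 2 → ℝ)) (σ : ℝ), σ = 1 ∨ σ = -1 →
    ∀ m : ℕ, 3 ≤ m →
      (∑ ℓ, (suc (Nσ a b c σ) (TPs a b c σ) m ℓ).card ≤ C * Fintype.card G) ∧
      (∑ ℓ, (suc (Nσ a b c σ) (TQs a b c σ) m ℓ).card ≤ C * Fintype.card G) ∧
      (∑ ℓ, (suc (Nσ a b c σ) (TRs a b c σ) m ℓ).card ≤ C * Fintype.card G) ∧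
      (∑ ℓ, (suc (Nσ a b c σ) (coTop (TPs a b c σ)) m ℓ).card ≤ C * Fintype.card G) ∧
      (∑ ℓ, (suc (Nσ a b c σ) (coTop (TQs a b c σ)) m ℓ).card ≤ C * Fintype.card G) ∧
      (∑ ℓ, (suc (Nσ a b c σ) (coTop (TRs a b c σ)) m ℓ).card ≤ C * Fintype.card G)

section Bridge

variable {G : Type*} [AddCommGroup G] [Fintype G] [DecidableEq G]

open Classical in
/-- **Per half-chart** (`σ ≠ 0`): under up-crossing budgets `B` for all six views at every level `2^j`, `j ≥ 2`,
`Σ_s #tops_σ(class s) ≤ 3·(3|G|² + 4|G|·B·log₂|G|)`. [folklore] -/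
theorem sum_card_chartTops_le_of_suc_le (a b c : G → (Fin 2 → ℝ)) {σ : ℝ} (hσ : σ ≠ 0) {B : ℕ}
    (hsuc : ∀ j, 2 ≤ j → j ≤ Nat.log 2 (Fintype.card G) →
      (∑ ℓ, (suc (Nσ a b c σ) (TPs a b c σ) (2 ^ j) ℓ).card ≤ B) ∧
      (∑ ℓ, (suc (Nσ a b c σ) (TQs a b c σ) (2 ^ j) ℓ).card ≤ B) ∧
      (∑ ℓ, (suc (Nσ a b c σ) (TRs a b c σ) (2 ^ j) ℓ).card ≤ B) ∧
      (∑ ℓ, (suc (Nσ a b c σ) (coTop (TPs a b c σ)) (2 ^ j) ℓ).card ≤ B) ∧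
      (∑ ℓ, (suc (Nσ a b c σ) (coTop (TQs a b c σ)) (2 ^ j) ℓ).card ≤ B) ∧
      (∑ ℓ, (suc (Nσ a b c σ) (coTop (TRs a b c σ)) (2 ^ j) ℓ).card ≤ B)) :
    ∑ s, ((univ.image fun p : G × G => a p.1 + b p.2 + c (s - p.1 - p.2)).filter fun v =>
        ∃ t, IsStrictTop ![σ, t] (univ.image fun p : G × G => a p.1 + b p.2 + c (s - p.1 - p.2)) v).card ≤
      3 * (3 * Fintype.card G ^ 2 + 4 * Fintype.card G * B * Nat.log 2 (Fintype.card G)) := by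
  classical
  set N := Nσ a b c σ
  set TP := TPs a b c σ
  set TQ := TQs a b c σ
  set TR := TRs a b c σ
  set M := 4 * Fintype.card G * B with hM
  have hP : ∀ j, 2 ≤ j → j ≤ Nat.log 2 (Fintype.card G) → 2 ^ j * (heavyPairs N TQ TR (2 ^ j)).card ≤ M :=
    fun j hj hJ => pow_mul_card_heavyPairs_le_of_suc_le TQ TR (by omega) (hsuc j hj hJ).2.1 (hsuc j hj hJ).2.2.1
  have hQ : ∀ j, 2 ≤ j → j ≤ Nat.log 2 (Fintype.card G) →
      2 ^ j * (heavyPairs N (coTop TR) (coTop TP) (2 ^ j)).card ≤ M :=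
    fun j hj hJ => pow_mul_card_heavyPairs_le_of_suc_le (coTop TR) (coTop TP) (by omega)
      (hsuc j hj hJ).2.2.2.2.2 (hsuc j hj hJ).2.2.2.1
  have hR : ∀ j, 2 ≤ j → j ≤ Nat.log 2 (Fintype.card G) →
      2 ^ j * (heavyPairs N (coTop TQ) TP (2 ^ j)).card ≤ M :=
    fun j hj hJ => pow_mul_card_heavyPairs_le_of_suc_le (coTop TQ) TP (by omega)
      (hsuc j hj hJ).2.2.2.2.1 (hsuc j hj hJ).1
  have bP := (card_bornP_le_sum_min (N := N) TP TQ TR).trans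
    (sum_min_topDeg_le_of_levels (TQ := TQ) (TR := TR) (fun p : G × G => birth N TP (p.1 + p.2) p.1)
      (fun p => birth_le _ _ _ _) hP)
  have bQ := (card_bornQ_le_sum_min (N := N) TP TQ TR).trans
    (sum_min_topDeg_le_of_levels (TQ := coTop TR) (TR := coTop TP) (fun p : G × G => birth N TQ (p.1 + p.2) p.1)
      (fun p => birth_le _ _ _ _) hQ)
  have bR := (card_bornR_le_sum_min (N := N) TP TQ TR).trans
    (sum_min_topDeg_le_of_levels (TQ := coTop TQ) (TR := TP) (fun p : G × G => birth N TR (p.1 + p.2) p.1)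
      (fun p => birth_le _ _ _ _) hR)
  have hPi := isIntervalSys_TPs (a := a) (b := b) (c := c) hσ N
  have hQi := isIntervalSys_TQs (a := a) (b := b) (c := c) hσ N
  have hRi := isIntervalSys_TRs (a := a) (b := b) (c := c) hσ N
  calc _ ≤ (triWords N TP TQ TR).card := sum_card_chartTops_le_card_triWords a b c σ
    _ ≤ _ := card_le_card (triWords_subset hPi hQi hRi)
    _ ≤ _ := card_union_le _ _
    _ ≤ _ + _ := Nat.add_le_add_right (card_union_le _ _) _
    _ ≤ (3 * Fintype.card G ^ 2 + M * Nat.log 2 (Fintype.card G)) +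
          (3 * Fintype.card G ^ 2 + M * Nat.log 2 (Fintype.card G)) +
          (3 * Fintype.card G ^ 2 + M * Nat.log 2 (Fintype.card G)) := by
        gcongr
    _ = 3 * (3 * Fintype.card G ^ 2 + 4 * Fintype.card G * B * Nat.log 2 (Fintype.card G)) := by rw [hM]; ring

/-- **THE BRIDGE: `UpCrossingLaw C → T ≤ (18 + 24·C·log₂|G|)·|G|²`** for every finite abelian `G` and all curves — the up-crossing
law would bring the general exponent of the totals from `5/2` down to `2` up to a logarithm. -/
theorem totalVert_le_of_upCrossingLaw (C : ℕ) (h : UpCrossingLaw C) :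
    ∀ (G : Type) [AddCommGroup G] [Fintype G] (a b c : G → (Fin 2 → ℝ)),
      totalVert a b c ≤ (18 + 24 * C * Nat.log 2 (Fintype.card G)) * Fintype.card G ^ 2 := by
  intro G _ _ a b c
  classical
  set q := Fintype.card G with hq
  have key : ∀ σ : ℝ, σ = 1 ∨ σ = -1 →
      ∑ s, ((univ.image fun p : G × G => a p.1 + b p.2 + c (s - p.1 - p.2)).filter fun v =>
        ∃ t, IsStrictTop ![σ, t] (univ.image fun p : G × G => a p.1 + b p.2 + c (s - p.1 - p.2)) v).card ≤
      3 * (3 * q ^ 2 + 4 * q * (C * q) * Nat.log 2 q) := by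
    intro σ hσ
    have hσ0 : σ ≠ 0 := by rcases hσ with rfl | rfl <;> norm_num
    refine sum_card_chartTops_le_of_suc_le a b c hσ0 fun j hj _ => ?_
    have h3 : 3 ≤ 2 ^ j := le_trans (by norm_num) (Nat.pow_le_pow_right (by norm_num) hj)
    exact h G a b c σ hσ (2 ^ j) h3
  have h₁ := key 1 (Or.inl rfl)
  have h₂ := key (-1) (Or.inr rfl)
  unfold totalVert
  calc ∑ s, classVert a b c s ≤ _ := sum_le_sum fun s _ => classVert_le_card_chartTops_add a b c s
    _ ≤ 3 * (3 * q ^ 2 + 4 * q * (C * q) * Nat.log 2 q) + 3 * (3 * q ^ 2 + 4 * q * (C * q) * Nat.log 2 q) := by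
        rw [sum_add_distrib]; exact add_le_add h₁ h₂
    _ = (18 + 24 * C * Nat.log 2 q) * q ^ 2 := by ring

end Bridge

end TotalsLaw

end Summit.ValiantsHypothesis.ValiantsHypothesis.Theorems.NewtonUnitEquationsDissociatedUniform
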